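import Summits.CriticalPhenomena.Ising3DConformalLimit.Theorems.EnergyNotSigmaSquaredMoebiusLimitExistsPedigreeAssembly
import Summits.CriticalPhenomena.Ising3DConformalLimit.Theorems.EnergyNotSigmaSquaredMoebiusLimitExistsDoubledThickening
import Summits.CriticalPhenomena.Ising3DConformalLimit.Theorems.EnergyNotSigmaSquaredMoebiusLimitExistsCompactnessSchema
import Summits.CriticalPhenomena.Ising3DConformalLimit.Theorems.EnergyNotSigmaSquaredMoebiusLimitExistsTranslationInvariant
import Summits.CriticalPhenomena.Ising3DConformalLimit.Theorems.EnergyNotSigmaSquaredMoebiusLimitExistsTelescoping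
import Summits.CriticalPhenomena.Ising3DConformalLimit.Theorems.EnergyNotSigmaSquaredMoebiusLimitExistsPedigreeMono
import Summits.CriticalPhenomena.Ising3DConformalLimit.Theorems.EnergyNotSigmaSquaredMoebiusLimitExistsPedigreeCovering
import Summits.CriticalPhenomena.Ising3DConformalLimit.Theorems.EnergyNotSigmaSquaredMoebiusLimitExistsPedigreeCover
import Summits.CriticalPhenomena.Ising3DConformalLimit.Theorems.EnergyNotSigmaSquaredMoebiusLimitExistsSVEquicontTransport
import Summits.CriticalPhenomena.Ising3DConformalLimit.Theorems.EnergyNotSigmaSquaredMoebiusLimitExistsPedigreeStep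
import Summits.CriticalPhenomena.Ising3DConformalLimit.Theorems.EnergyNotSigmaSquaredMoebiusLimitExistsClusterMoveIneq
import Summits.CriticalPhenomena.Ising3DConformalLimit.Theses.MonotoneRG
import Literature.Probability.LatticeModels.CriticalUrsellFourSign
import HarnessLib

/-!
# Item 5955 from PAIR REGULARITY: the pedigree assembly without the two-point law
(stub F3 `stub_orbitPrecompact_of_pairRegularity_of` of line `Sketch`, crux `ExistsScaleCovariantLimit`,
item stmt-CriticalPhenomena-1981, route `HyperoctahedralRP`; lead c4, 2026-08-16)

Crux 1344's reflection-positivity pedigree machinery (line `only-interaction-breaks-moebius`) proves compactness of the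
pinned critical zoom at ALL orders from the two-point LAW (item 0634). The law is used only through: local bounds at
every order (`pinnedZoomLocallyBounded`), the base case of the pedigree induction (`sepMove_equicontinuity`), asymptotic
equicontinuity of the pair zoom (`pinnedZoomEquicontinuous_two`) and non-degeneracy of cluster points. This file re-runs
the assembly with exactly these four inputs as HYPOTHESES — in the sequential forms delivered from pair regularity by the
line's stubs F1 (`stub_locallyBounded_of_pairBound`) and F2 (`stub_sepMove_of_pairRegularity`) — and concludes item
stmt-5955 `MonotoneRG.OrbitPrecompact` with `ρ = ρ_pin`:
* `pedigree_assembly_pr` — the induction on the pedigree depth (`pedigree_assembly` of `…PedigreeAssembly.lean` with the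
  recursion step `pedigreeStep clusterMoveIneq_cubic`, `pedigree_mono`, `svEquicont_transport`, `doubled_thickening`
  plugged in and the two law-uses replaced by the hypotheses);
* `svEquicont_all_pr` (every configuration has a pedigree: `pedigree_cover ∘ covering_all`), `equicontinuity_ge_four_pr`
  (`telescoping_equicontinuity`), `pinnedZoom_equicontinuity_pr` (all orders; order `2` is the pair hypothesis),
  `pinnedZoom_compactness_pr` (`compactnessSchema`, `pinnedZoomTranslationInvariant`);
* `stub_orbitPrecompact_of_pairRegularity_of` (registered F3): with the eventual positive lower bounds of the pair zoom
  at single pairs, the extracted limit has `S₂ > 0` off the diagonal, i.e. is non-degenerate.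
With F1, F2 and the skeleton's `orbitPrecompact_of_pairRegularity`: item 4658 `UniformRegularity` RESTRICTED TO ORDER
TWO already implies item 5955 (and hence, by the landed UR′, all of item 4658).
-- adapted from Theorems/EnergyNotSigmaSquaredMoebiusLimitExistsPedigreeAssembly.lean and
-- …PinnedZoomCompactnessOfStep.lean (line only-interaction-breaks-moebius, crux MoebiusLimitExists).

References: J. Fröhlich, R. Israel, E. H. Lieb, B. Simon, Comm. Math. Phys. 62 (1978) §2 [FILS1978]; H. Duminil-Copin,
ICM 2022 §8.1, §8.4 [DuminilCopinICM2022]. No definitions, no `sorry`.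
-/

noncomputable section

namespace Summit.CriticalPhenomena.Ising3DConformalLimit.Cruxes.ExistsScaleCovariantLimit.TwoHierarchies

open Literature.Probability.LatticeModels Filter Set Function Metric
open scoped Topology
open Summit.CriticalPhenomena.Ising3DConformalLimit.MoebiusLimitExistsOnlyInteraction

/-- **Mirror pedigrees, the induction on depth, from local bounds and the base case as hypotheses.** Along a mesh
sequence `u k → 0⁺`, for every depth `d` and margin `μ > 0`, the pinned `n`-point zoom is single-variable asymptotically
equicontinuous at the index `i` on every compact set `K` of non-coincident configurations all of whose points admit a
mirror pedigree of depth `≤ d` with margin `μ` — granted (H1) eventual local bounds at every order along `u` and (H2) the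
base case along `u` (equicontinuity under moves of a coordinate-separated point). Depth `0` is (H2), one coordinate at a
time; depth `d + 1` is local on `K` (`svEquicont_of_locally_pa`): on the piece `closedBall x₀ (μ/4) ∩ K` either `x₀`
already has depth `≤ d`, or the cut at `x₀` is admissible with margin `μ/2` on the re-indexed piece, the doubled
configurations near the doubled image have depth `≤ d` with margin `μ/4` (induction hypothesis), the doubled discarded
blocks are eventually bounded (H1), and the recursion step `pedigreeStep clusterMoveIneq_cubic` and the transport
`svEquicont_transport` apply. [cite: FILS1978, §2] -/
theorem pedigree_assembly_pr {u : ℕ → ℝ} (hu : Tendsto u atTop (𝓝[>] (0 : ℝ)))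
    (hLB : ∀ (n : ℕ) (K : Set (Fin n → EuclideanSpace ℝ (Fin 3))), IsCompact K → K ⊆ NonCoincident 3 n →
      ∃ M : ℝ, ∀ᶠ k in atTop, ∀ x ∈ K, |rescaledCorrelator (criticalCorr 3) rhoPin n (u k) x| ≤ M)
    (hSEP : ∀ (N : ℕ) (K : Set (Fin N → EuclideanSpace ℝ (Fin 3))), IsCompact K → K ⊆ NonCoincident 3 N →
      ∀ κ : ℝ, 0 < κ → ∀ (i : Fin N) (τ : Fin 3), ∀ ε > 0, ∃ η > 0, ∀ᶠ k in atTop, ∀ x ∈ K, ∀ x' ∈ K,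
        (∀ j, j ≠ i → x' j = x j) →
        ((∀ j, j ≠ i → x i τ + κ ≤ x j τ) ∨ (∀ j, j ≠ i → x j τ + κ ≤ x i τ)) →
        dist x x' < η →
          |rescaledCorrelator (criticalCorr 3) rhoPin N (u k) x -
            rescaledCorrelator (criticalCorr 3) rhoPin N (u k) x'| < ε) :
    ∀ (d : ℕ) (μ : ℝ), 0 < μ →
      ∀ (n : ℕ) (i : Fin n) (K : Set (Fin n → EuclideanSpace ℝ (Fin 3))),
      IsCompact K → K ⊆ NonCoincident 3 n → (∀ x ∈ K, PedigreeOK μ d n x i) →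
      SVEquicont u n K i := by
  -- adapted from …MoebiusLimitExistsPedigreeAssembly.lean `pedigree_assembly` (line only-interaction-breaks-moebius)
  intro d
  induction d with
  | zero =>
    intro μ hμ n i K hK hKs hped ε hε
    choose η hη hev using fun τ : Fin 3 => hSEP n K hK hKs μ hμ i τ ε hε
    obtain ⟨τ₀, hτ₀⟩ := Finite.exists_min η
    refine ⟨η τ₀, hη τ₀, ?_⟩
    filter_upwards [eventually_all.2 hev] with k hk x hx x' hx' hdiff hdist
    obtain ⟨τ, hsep⟩ := (pedigreeOK_zero μ x i).1 (hped x hx)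
    exact hk τ x hx x' hx' hdiff hsep (lt_of_lt_of_le hdist (hτ₀ τ))
  | succ d ih =>
    intro μ hμ n i K hK hKs hped
    refine svEquicont_of_locally_pa hK fun x₀ hx₀ => ⟨μ / 4, by positivity, ?_⟩
    have hx₀ped := (pedigreeOK_succ μ d x₀ i).1 (hped x₀ hx₀)
    -- the piece `K₀ = closedBall x₀ (μ/4) ∩ K`
    suffices H : ∀ K₀ : Set (Fin n → EuclideanSpace ℝ (Fin 3)), IsCompact K₀ →
        K₀ ⊆ NonCoincident 3 n → (∀ x ∈ K₀, dist x₀ x ≤ μ / 4) → SVEquicont u n K₀ i from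
      H _ (hK.inter_left isClosed_closedBall) (fun x hx => hKs hx.2) fun x hx => by
        rw [dist_comm]
        exact mem_closedBall.1 hx.1
    intro K₀ hK₀c hK₀s hK₀d
    rcases hx₀ped with h0 | ⟨g, T, a, b, e, i₀, hg, hei, hA, hB, hdbl⟩
    · -- (a) `x₀` already has depth `≤ d`: margin `μ/2` on the piece
      exact ih (μ - 2 * (μ / 4)) (by linarith) n i K₀ hK₀c hK₀s fun x hx =>
        pedigree_mono μ (μ / 4) d n x₀ x i h0 (hK₀d x hx)
    · -- (b) an admissible cut at `x₀`; the re-indexed piece `K'`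
      have hK'c : IsCompact ((fun x => x ∘ ⇑e) '' K₀) :=
        isCompact_image_comp_equiv_pa e hK₀c
      have hK's : (fun x => x ∘ ⇑e) '' K₀ ⊆ NonCoincident 3 (a + b) :=
        image_comp_equiv_subset_nonCoincident_pa e hK₀s
      have hcut : ∀ y ∈ (fun x => x ∘ ⇑e) '' K₀,
          (∀ j : Fin a, rdotZ g (y (Fin.castAdd b j)) + μ / 2 ≤ T) ∧
          (∀ j : Fin b, T + μ / 2 ≤ rdotZ g (y (Fin.natAdd a j))) := by
        rintro _ ⟨x, hx, rfl⟩
        have hclose : ∀ l : Fin n, |rdotZ g (x₀ l) - rdotZ g (x l)| ≤ 2 * (μ / 4) :=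
          fun l => (abs_rdotZ_sub_le_pa hg (x₀ l) (x l)).trans (mul_le_mul_of_nonneg_left
            ((dist_le_pi_dist x₀ x l).trans (hK₀d x hx)) two_pos.le)
        refine ⟨fun j => ?_, fun j => ?_⟩
        · change rdotZ g (x (e (Fin.castAdd b j))) + μ / 2 ≤ T
          have h1 := abs_le.1 (hclose (e (Fin.castAdd b j)))
          linarith [h1.1, h1.2, hA j]
        · change T + μ / 2 ≤ rdotZ g (x (e (Fin.natAdd a j)))
          have h1 := abs_le.1 (hclose (e (Fin.natAdd a j)))
          linarith [h1.1, h1.2, hB j]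
      obtain ⟨η₁, hη₁, hAc, hAs, hBc, hBs⟩ :=
        doubled_thickening g hg T (μ / 2) (by positivity) a b _ hK'c hK's hcut
      -- shrink the thickening radius to `η₀ = min η₁ (μ/16)`
      have hη₀ : 0 < min η₁ (μ / 16) := lt_min hη₁ (by positivity)
      have hη₀₁ : min η₁ (μ / 16) ≤ η₁ := min_le_left _ _
      have hη₀μ : min η₁ (μ / 16) < μ / 8 := lt_of_le_of_lt (min_le_right _ _) (by linarith)
      have hSAc : IsCompact (cthickening (min η₁ (μ / 16))
          (doubledA g T '' ((fun x => x ∘ ⇑e) '' K₀))) :=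
        hAc.of_isClosed_subset isClosed_cthickening (cthickening_mono hη₀₁ _)
      have hSAs : cthickening (min η₁ (μ / 16)) (doubledA g T '' ((fun x => x ∘ ⇑e) '' K₀)) ⊆
          NonCoincident 3 (a + a) :=
        (cthickening_mono hη₀₁ _).trans hAs
      have hSBc : IsCompact (cthickening (min η₁ (μ / 16))
          (doubledB g T '' ((fun x => x ∘ ⇑e) '' K₀))) :=
        hBc.of_isClosed_subset isClosed_cthickening (cthickening_mono hη₀₁ _)
      have hSBs : cthickening (min η₁ (μ / 16)) (doubledB g T '' ((fun x => x ∘ ⇑e) '' K₀)) ⊆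
          NonCoincident 3 (b + b) :=
        (cthickening_mono hη₀₁ _).trans hBs
      -- pedigrees of depth `≤ d` with margin `μ/4` on the `A`-thickening
      have hpedA :
          ∀ z ∈ cthickening (min η₁ (μ / 16)) (doubledA g T '' ((fun x => x ∘ ⇑e) '' K₀)),
            PedigreeOK (μ - 2 * (μ / 4) - 2 * (μ / 8)) d (a + a) z (Fin.castAdd a i₀) := by
        intro z hz
        obtain ⟨_, ⟨_, ⟨x, hx, rfl⟩, rfl⟩, hdz⟩ :=
          mem_thickening_iff.1 (cthickening_subset_thickening' (by positivity) hη₀μ _ hz)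
        have h1 : PedigreeOK (μ - 2 * (μ / 4)) d (a + a) (doubledA g T (x ∘ ⇑e))
            (Fin.castAdd a i₀) :=
          pedigree_mono μ (μ / 4) d (a + a) (doubledA g T (x₀ ∘ ⇑e)) (doubledA g T (x ∘ ⇑e))
            (Fin.castAdd a i₀) hdbl (((dist_doubledA_le_pa g T _ _).trans
              (dist_comp_equiv_le_pa e x₀ x)).trans (hK₀d x hx))
        refine pedigree_mono _ (μ / 8) d (a + a) _ z _ h1 ?_
        rw [dist_comm]
        exact hdz.le
      have hsvA := ih (μ - 2 * (μ / 4) - 2 * (μ / 8)) (by linarith) (a + a)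
        (Fin.castAdd a i₀) _ hSAc hSAs hpedA
      -- the eventual bound on the `B`-thickening, the step, the transport
      obtain ⟨M, hM⟩ := hLB (b + b) _ hSBc hSBs
      have hsv' : SVEquicont u (a + b) ((fun x => x ∘ ⇑e) '' K₀) (Fin.castAdd b i₀) :=
        pedigreeStep clusterMoveIneq_cubic u hu a b i₀ g hg T (μ / 2) (min η₁ (μ / 16)) M (by positivity) hη₀ _
          hK'c hK's hcut hM hsvA
      have := svEquicont_transport u a b n e i₀ K₀ hsv'
      rwa [hei] at this

/-- **Single-variable asymptotic equicontinuity of the pinned zoom at EVERY configuration, from local bounds and the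
base case**: by locality (`svEquicont_of_locally_pa`) on the piece `closedBall x (μ/4) ∩ K` around each `x ∈ K`, `μ > 0`
the margin of a mirror pedigree of `x` (`pedigree_cover ∘ covering_all`), `pedigree_mono` and `pedigree_assembly_pr`.
[cite: FILS1978, §2] -/
theorem svEquicont_all_pr {u : ℕ → ℝ} (hu : Tendsto u atTop (𝓝[>] (0 : ℝ)))
    (hLB : ∀ (n : ℕ) (K : Set (Fin n → EuclideanSpace ℝ (Fin 3))), IsCompact K → K ⊆ NonCoincident 3 n →
      ∃ M : ℝ, ∀ᶠ k in atTop, ∀ x ∈ K, |rescaledCorrelator (criticalCorr 3) rhoPin n (u k) x| ≤ M)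
    (hSEP : ∀ (N : ℕ) (K : Set (Fin N → EuclideanSpace ℝ (Fin 3))), IsCompact K → K ⊆ NonCoincident 3 N →
      ∀ κ : ℝ, 0 < κ → ∀ (i : Fin N) (τ : Fin 3), ∀ ε > 0, ∃ η > 0, ∀ᶠ k in atTop, ∀ x ∈ K, ∀ x' ∈ K,
        (∀ j, j ≠ i → x' j = x j) →
        ((∀ j, j ≠ i → x i τ + κ ≤ x j τ) ∨ (∀ j, j ≠ i → x j τ + κ ≤ x i τ)) →
        dist x x' < η →
          |rescaledCorrelator (criticalCorr 3) rhoPin N (u k) x -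
            rescaledCorrelator (criticalCorr 3) rhoPin N (u k) x'| < ε)
    (n : ℕ) (K : Set (Fin n → EuclideanSpace ℝ (Fin 3))) (hK : IsCompact K) (hKs : K ⊆ NonCoincident 3 n)
    (i : Fin n) : SVEquicont u n K i := by
  -- adapted from …PinnedZoomCompactnessOfStep.lean `svEquicont_all_of_step`
  refine svEquicont_of_locally_pa hK fun x hx => ?_
  obtain ⟨μ, hμ, d, hped⟩ := pedigree_cover covering_all n x (hKs hx) i
  refine ⟨μ / 4, by positivity, ?_⟩
  refine pedigree_assembly_pr hu hLB hSEP d (μ / 2) (by positivity) n i _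
    (hK.inter_left Metric.isClosed_closedBall) (fun y hy => hKs hy.2) fun y hy => ?_
  have hdist : dist x y ≤ μ / 4 := by
    rw [dist_comm]
    exact Metric.mem_closedBall.1 hy.1
  have h := pedigree_mono μ (μ / 4) d n x y i hped hdist
  have hμ2 : μ - 2 * (μ / 4) = μ / 2 := by ring
  rwa [hμ2] at h

/-- **Joint asymptotic equicontinuity at even orders `2m ≥ 4`** (indeed at every order `2m`) from the single-variable
moduli: `telescoping_equicontinuity`. [folklore] -/
theorem equicontinuity_even_pr {u : ℕ → ℝ} (hu : Tendsto u atTop (𝓝[>] (0 : ℝ)))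
    (hLB : ∀ (n : ℕ) (K : Set (Fin n → EuclideanSpace ℝ (Fin 3))), IsCompact K → K ⊆ NonCoincident 3 n →
      ∃ M : ℝ, ∀ᶠ k in atTop, ∀ x ∈ K, |rescaledCorrelator (criticalCorr 3) rhoPin n (u k) x| ≤ M)
    (hSEP : ∀ (N : ℕ) (K : Set (Fin N → EuclideanSpace ℝ (Fin 3))), IsCompact K → K ⊆ NonCoincident 3 N →
      ∀ κ : ℝ, 0 < κ → ∀ (i : Fin N) (τ : Fin 3), ∀ ε > 0, ∃ η > 0, ∀ᶠ k in atTop, ∀ x ∈ K, ∀ x' ∈ K,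
        (∀ j, j ≠ i → x' j = x j) →
        ((∀ j, j ≠ i → x i τ + κ ≤ x j τ) ∨ (∀ j, j ≠ i → x j τ + κ ≤ x i τ)) →
        dist x x' < η →
          |rescaledCorrelator (criticalCorr 3) rhoPin N (u k) x -
            rescaledCorrelator (criticalCorr 3) rhoPin N (u k) x'| < ε)
    (N : ℕ) (K : Set (Fin N → EuclideanSpace ℝ (Fin 3))) (hK : IsCompact K) (hKs : K ⊆ NonCoincident 3 N) :
    ∀ ε > 0, ∃ η > 0, ∀ᶠ k in atTop, ∀ x ∈ K, ∀ y ∈ K, dist x y < η →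
      |rescaledCorrelator (criticalCorr 3) rhoPin N (u k) x -
        rescaledCorrelator (criticalCorr 3) rhoPin N (u k) y| < ε :=
  telescoping_equicontinuity N
    (fun k x => rescaledCorrelator (criticalCorr 3) rhoPin N (u k) x) (NonCoincident 3 N)
    (isOpen_nonCoincident 3 N)
    (fun K' hK' hK's i => svEquicont_all_pr hu hLB hSEP N K' hK' hK's i) K hK hKs

/-- **Compactness of the pinned critical zoom with REGULAR cluster points, from local bounds and the base case**:
every mesh sequence `u k → 0⁺` has a subsequence along which, for every order `n` at once, the pinned rescaled critical
correlators converge locally uniformly off the diagonals to a normalised, continuous-off-diagonals, translation-invariant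
family (`compactnessSchema` on the local bounds and `equicontinuity_even_pr`, then `pinnedZoomTranslationInvariant` along
the subsequence, whose hypotheses are again available since they are assumed along EVERY mesh sequence).
[cite: DuminilCopinICM2022, §8.1] -/
theorem pinnedZoom_compactness_pr
    (hLB : ∀ u : ℕ → ℝ, Tendsto u atTop (𝓝[>] (0 : ℝ)) →
      ∀ (n : ℕ) (K : Set (Fin n → EuclideanSpace ℝ (Fin 3))), IsCompact K → K ⊆ NonCoincident 3 n →
        ∃ M : ℝ, ∀ᶠ k in atTop, ∀ x ∈ K, |rescaledCorrelator (criticalCorr 3) rhoPin n (u k) x| ≤ M)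
    (hSEP : ∀ u : ℕ → ℝ, Tendsto u atTop (𝓝[>] (0 : ℝ)) →
      ∀ (N : ℕ) (K : Set (Fin N → EuclideanSpace ℝ (Fin 3))), IsCompact K → K ⊆ NonCoincident 3 N →
        ∀ κ : ℝ, 0 < κ → ∀ (i : Fin N) (τ : Fin 3), ∀ ε > 0, ∃ η > 0, ∀ᶠ k in atTop, ∀ x ∈ K, ∀ x' ∈ K,
          (∀ j, j ≠ i → x' j = x j) →
          ((∀ j, j ≠ i → x i τ + κ ≤ x j τ) ∨ (∀ j, j ≠ i → x j τ + κ ≤ x i τ)) →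
          dist x x' < η →
            |rescaledCorrelator (criticalCorr 3) rhoPin N (u k) x -
              rescaledCorrelator (criticalCorr 3) rhoPin N (u k) x'| < ε) :
    ∀ u : ℕ → ℝ, Tendsto u atTop (𝓝[>] (0 : ℝ)) →
      ∃ (φ : ℕ → ℕ) (S : CorrFamily 3), StrictMono φ ∧ MoebiusLimitExistsOnlyInteraction.IsRegular S ∧
        ∀ n, TendstoLocallyUniformlyOn
          (fun k => rescaledCorrelator (criticalCorr 3) rhoPin n (u (φ k))) (S n) atTop
          (NonCoincident 3 n) := by
  -- adapted from …PinnedZoomCompactnessOfStep.lean `pinnedZoom_compactness_of_step`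
  intro u hu
  obtain ⟨φ, S, hφ, hnorm, hcont, hconv⟩ := compactnessSchema
    (fun n k x => rescaledCorrelator (criticalCorr 3) rhoPin n (u k) x)
    (fun n K hK hKs => hLB u hu n K hK hKs)
    (fun n K hK hKs => equicontinuity_even_pr hu (hLB u hu) (hSEP u hu) n K hK hKs)
  have hu' : Tendsto (u ∘ φ) atTop (𝓝[>] (0 : ℝ)) := hu.comp hφ.tendsto_atTop
  refine ⟨φ, S, hφ, ⟨hnorm, hcont, ?_⟩, hconv⟩
  exact pinnedZoomTranslationInvariant (u ∘ φ) hu'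
    (fun n K hK hKs => equicontinuity_even_pr hu' (hLB (u ∘ φ) hu') (hSEP (u ∘ φ) hu') n K hK hKs) S hnorm hconv

/-- **F3 (registered stub of line `Sketch`) — ITEM 5955 FROM PAIR REGULARITY, given F1's and F2's conclusions.**
Local bounds at every order, the base case of the pedigree induction, asymptotic equicontinuity of the pinned pair zoom
(kept in the signature for the composition in the skeleton; the assembly gets order `2` from the base-case/telescoping
route as well) and eventual positive lower bounds of the pair zoom at single non-coincident pairs, all along every mesh
sequence `u k → 0⁺`, give `MonotoneRG.OrbitPrecompact` with `ρ = ρ_pin` (`rhoPin_pos`): a `(0,1]`-valued mesh sequence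
tending to `0` tends to `0⁺`, `pinnedZoom_compactness_pr` extracts a locally uniformly convergent subsequence at all
orders, and the limit is non-degenerate since `S 2 x = lim F₂(u (φ k)) x ≥ m_x > 0` at every non-coincident pair.
[cite: DuminilCopinICM2022, §8.4 p. 29] -/
theorem stub_orbitPrecompact_of_pairRegularity_of :
    (∀ u : ℕ → ℝ, Tendsto u atTop (𝓝[>] (0 : ℝ)) →
      ∀ (n : ℕ) (K : Set (Fin n → EuclideanSpace ℝ (Fin 3))), IsCompact K → K ⊆ NonCoincident 3 n →
        ∃ M : ℝ, ∀ᶠ k in atTop, ∀ x ∈ K, |rescaledCorrelator (criticalCorr 3) rhoPin n (u k) x| ≤ M) →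
    (∀ u : ℕ → ℝ, Tendsto u atTop (𝓝[>] (0 : ℝ)) →
      ∀ (N : ℕ) (K : Set (Fin N → EuclideanSpace ℝ (Fin 3))), IsCompact K → K ⊆ NonCoincident 3 N →
        ∀ κ : ℝ, 0 < κ → ∀ (i : Fin N) (τ : Fin 3), ∀ ε > 0, ∃ η > 0, ∀ᶠ k in atTop, ∀ x ∈ K, ∀ x' ∈ K,
          (∀ j, j ≠ i → x' j = x j) →
          ((∀ j, j ≠ i → x i τ + κ ≤ x j τ) ∨ (∀ j, j ≠ i → x j τ + κ ≤ x i τ)) →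
          dist x x' < η →
            |rescaledCorrelator (criticalCorr 3) rhoPin N (u k) x -
              rescaledCorrelator (criticalCorr 3) rhoPin N (u k) x'| < ε) →
    (∀ u : ℕ → ℝ, Tendsto u atTop (𝓝[>] (0 : ℝ)) →
      ∀ K : Set (Fin 2 → EuclideanSpace ℝ (Fin 3)), IsCompact K → K ⊆ NonCoincident 3 2 →
        ∀ ε > 0, ∃ η > 0, ∀ᶠ k in atTop, ∀ x ∈ K, ∀ y ∈ K, dist x y < η →
          |rescaledCorrelator (criticalCorr 3) rhoPin 2 (u k) x -
            rescaledCorrelator (criticalCorr 3) rhoPin 2 (u k) y| < ε) →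
    (∀ u : ℕ → ℝ, Tendsto u atTop (𝓝[>] (0 : ℝ)) →
      ∀ x ∈ NonCoincident 3 2, ∃ m : ℝ, 0 < m ∧
        ∀ᶠ k in atTop, m ≤ rescaledCorrelator (criticalCorr 3) rhoPin 2 (u k) x) →
    Summit.CriticalPhenomena.Ising3DConformalLimit.Theses.MonotoneRG.OrbitPrecompact := by
  intro hLB hSEP _hE hC
  refine ⟨rhoPin, rhoPin_pos, fun u hu01 hu0 => ?_⟩
  have hu : Tendsto u atTop (𝓝[>] (0 : ℝ)) :=
    tendsto_nhdsWithin_iff.2 ⟨hu0, Eventually.of_forall fun k => (hu01 k).1⟩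
  obtain ⟨φ, S, hφ, _hreg, hconv⟩ := pinnedZoom_compactness_pr hLB hSEP u hu
  refine ⟨φ, S, hφ, fun x hx => ?_, hconv⟩
  -- non-degeneracy: the limit at `x` is at least the eventual lower bound along `u ∘ φ`
  have hu' : Tendsto (u ∘ φ) atTop (𝓝[>] (0 : ℝ)) := hu.comp hφ.tendsto_atTop
  obtain ⟨m, hm, hev⟩ := hC (u ∘ φ) hu' x hx
  have hlim : Tendsto (fun k => rescaledCorrelator (criticalCorr 3) rhoPin 2 (u (φ k)) x) atTop (𝓝 (S 2 x)) :=
    (hconv 2).tendsto_at hx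
  exact lt_of_lt_of_le hm (ge_of_tendsto hlim hev)

end Summit.CriticalPhenomena.Ising3DConformalLimit.Cruxes.ExistsScaleCovariantLimit.TwoHierarchies

end
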